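import Literature.MathematicalPhysics.QuantumFieldTheory.Balaban1983to89.Step

/-!
# DressedRitz ★20205 — crux idea «cauchy-parity», rev 2 (crux-ideate #1, round 1, seat ym-cruxidea-20205-1 GEN 3):
# LOG-DEPTH STOPPING — gauge-blindness + the wrapping census over the COMPLETE inductive description

WHAT CHANGED (referee-grade reading of the printed domains, GEN 3).  Rev 1 bet that the E-terms of a Bałaban tower run to
an O(1) number of top blocks are analytic on the ABSOLUTE strip of [Balaban1987RG1] p. 263 (`Step.SFHyp`, small-field
approximation).  In the complete model they are not: [Balaban1988Convergent] p. 259 (ii) + (2.28) put `𝐄^{(j)}(X,·)` on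
the RUNNING space `U^c_j(X, α_{0,j}, α_{1,j})`, `α_{i,j} = g_j C_i (log g_j⁻²)^{q_i}` (tree: `Step.LFConsts.alpha0/alpha1`,
`Step.LFHyp.boundE`); the `𝐑`-terms likewise ((2.30)–(2.31) p. 260, `boundR`), the `𝐁`-terms on `Ũ_j` ((2.34)–(2.42)
p. 261, `boundB`); and the newly created E-terms are built from integrands containing running-domain R/B-terms (p. 262), so
an absolute strip is neither printed nor inherited.  Moreover the complete scheme cannot reach an O(1) torus at all: the
lattice is partitioned into `M R_j`-cubes, `R_j` the smallest power of `L` with `R_j ≥ (log g_j⁻²)^r`, `r ≥ 2` (p. 245, (2.5)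
p. 255), the localization domains of the E/R/B-terms are unions of them (p. 259–260) and the large-field geometry refers to cubes
of size `100 M R_j` (p. 255); so the LAST ADMISSIBLE SCALE `K` has `N_K/M ≳ R_K`, i.e. `N_K = polylog(1/g_K)` blocks across the
spatial torus (with the paper's geometric factors, `N_K ≍ 100·M·R_K`).

THE REV-2 LEVER.  Hand over from RG to semiclassics exactly there.  Below scale `K` nothing beyond the VERBATIM inductive
clauses is owed by the RG family, because of two facts typed in §1–§2 of this file:
 (G) GAUGE-BLINDNESS (`holonomyBlindE/R`): a localized gauge-invariant term whose (non-wrapping) domain sees the constant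
     abelian background `θ` as a gauge transform of the reference configuration does not depend on `θ` at all
     (`LFHyp.localDepE/R` + `gaugeInvE/R`, [Balaban1988Convergent] (2.27)(i),(iii) p. 259, (2.30) p. 260; for the B-terms the
     printed invariance (iii) p. 261 also transforms the fluctuation fields `A` and is not a field of `LFHyp` — informal);
 (W) WRAPPING CENSUS (`wrappingBoundE/R/B`, `pow_mul_exp_neg_le_of_log_le`, `scaleSum_le`, `census`,
     `depth_beats_any_power`): a domain that wraps the torus at scale `j` has `d_j(X) ≥ N_j/M` ([Balaban1987RG1] p. 257:
     `d_j(X)` = shortest tree length in `M`-cube units), hence SUP norm `≤ (E₀ | g_j^{κ₀} | B₀)·e^{−κ N_j/M}`; summed over the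
     `≲ N_j⁴·C^{N_j/M}` wrapping domains per fine time step and over the scales `N_j = N_K M^{K−j}` (a geometric series
     dominated by the top, `scaleSum_le`), the sum of ALL wrapping terms of the tower — the only part of the handed-over
     action that is not a θ-blind gauge-invariant local functional — is `≤ 2·V·E·N_K⁴ e^{−κ′N_K/M}` in sup norm per fine time
     step, and at Bałaban's own depth `N_K/M ≥ R_K ≥ (log g_K⁻²)²` this is `≤ g_K^A` for EVERY power `A`
     (`depth_beats_any_power`) — in particular `≪ Λ²/L`, the (E5) budget.  SUP BOUNDS ONLY: no analyticity in `θ`, no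
     evenness, no effective-potential coefficient is asked of the RG (a Cauchy estimate on the running strip would even be
     WORSE than the sup bound: it costs `α_{1,j}⁻² ∼ g⁻²` against a gain `θ² ∼ g^{4/3}`).  CONSISTENCY: the genuine `O(Λ²/L)`
     holonomy potential (Lüscher's/van Baal's one-loop `V₁`, coefficient `κ₁`) is generated by the TOP lattice's own
     torus-wavelength charged modes inside the top problem below — not by the tower: a scale-`j` fluctuation feels the holonomy
     only by propagating around the torus, which its covariance suppresses by `e^{−O(N_j)}`; blindness is a statement about the
     terms at fixed fluctuation field in the patchwise axial gauge, and the two-sided tolerance `exp(±C·Λ²/L)` absorbs `V₁`.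
Above scale `K` sits a SINGLE-SCALE problem (the card's (Z″)): lattice Yang–Mills on `N_K³ × ℤ`, `N_K = polylog(1/g_K)`, at
coupling `g_K`, with the (θ-blind, irrelevant) non-wrapping tower terms as small analytic perturbations; its effective expansion
parameter is `g_K²·N_K^{c} → 0`, so ONE cluster expansion in the fast variables with the constant modes as collective
coordinates (no renormalization, no induction over scales) reduces the low spectrum to the one-site model `oneSiteCoupling β L`
to relative `O(g^{2/3})`; the Cauchy–parity engine of rev 1 (`CauchyParity.norm_sub_le_of_even`, tree) is used THERE, on
genuinely finite-dimensional analytic data, to get the `θ²`-law of the fast ground energy without computing Lüscher's `κ₁`.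

WHAT IS PROVED HERE (0 sorry, over tree declarations only): §1 `holonomyBlindE`, `holonomyBlindR`, `wrappingBoundE/R/B`
(docked on `Step.LFHyp`, the typed (2.27)/(2.31)/(2.42)); §2 the census arithmetic: `pow_mul_exp_neg_le`
(`xⁿe^{−κx} ≤ n!(2/κ)ⁿe^{−κx/2}`), `pow_mul_exp_neg_le_of_log_le` (explicit log-depth threshold), `scaleSum_le` (the scales
below the top add at most a factor 2), `census` (the per-time-step budget), `depth_beats_any_power` (at depth `≥ a(log g⁻²)²`
the budget is below `g^A` for every `A`, `g` small).  NOT proved and not typeable today (the card's asks): that the femto-window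
transfer spectrum is governed by such a tower on `L³ × T` down to `N_K/M ≍ R_K` ((T″) = [Balaban1988Convergent] Thm 1 + the
large-field papers it cites as [18, 19], adapted to the anisotropic torus), the count `≤ V·N_j⁴·C^{N_j/M}` of wrapping domains,
the perturbation-transfer lemma (P) and the single-scale top analysis (Z″).
-/

noncomputable section

open Real Finset

namespace Summit.QuantumFields.YangMills.Cruxes.DressedRitz.CauchyParity.LogDepth

open Literature.MathematicalPhysics.QuantumFieldTheory.Balaban1983to89
open Literature.MathematicalPhysics.QuantumFieldTheory.Balaban1983to89.Step

/-! ## §1  Docking on the complete inductive description `Step.LFHyp` ([Balaban1988Convergent] §2) -/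

section Docking

variable {P : Params} {G : Type*} [GaugeGroup G] {Φ 𝒢 𝔄 : Type*} {T : LFTower P G Φ 𝒢 𝔄} {c : LFConsts} {k : ℕ}

/-- [folklore] GAUGE-BLINDNESS, E-species: if on `X` the configuration `φθ` (constant abelian background `θ` composed with the
minimizers) agrees with a gauge transform of the reference `φ₀` — which is the case for every NON-WRAPPING `X`, a flat connection
being pure gauge on a simply connected region — then `𝐄^{(j)}(X, z, g, φθ) = 𝐄^{(j)}(X, z, g, φ₀)`: the term carries no holonomy
dependence.  Uses only (2.27)(i) local dependence and (iii) gauge invariance. [cite: Balaban1988Convergent, (2.27)(i),(iii) p.259] -/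
theorem holonomyBlindE (h : LFHyp T c k) {j : ℕ} (h1 : 1 ≤ j) (hj : j ≤ k) (X : (T.sys j).Dom) (z : T.Pt j)
    (g : ℝ) (u : 𝒢) (φθ φ₀ : Φ) (hagree : T.agreeOn j X φθ (T.act u φ₀)) :
    T.E j X z g φθ = T.E j X z g φ₀ := by
  rw [h.localDepE j h1 hj X z g φθ (T.act u φ₀) hagree, h.gaugeInvE j h1 hj]

/-- [folklore] GAUGE-BLINDNESS, R-species ((2.30): "They have the properties (i)–(iii) above"). [cite: Balaban1988Convergent, (2.30)–(2.31) p.260] -/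
theorem holonomyBlindR (h : LFHyp T c k) {j : ℕ} (h1 : 1 ≤ j) (hj : j ≤ k) (X : (T.sys j).Dom)
    (u : 𝒢) (φθ φ₀ : Φ) (hagree : T.agreeOn j X φθ (T.act u φ₀)) :
    T.R j X φθ = T.R j X φ₀ := by
  rw [h.localDepR j h1 hj X φθ (T.act u φ₀) hagree, h.gaugeInvR j h1 hj]

/-- [folklore] Monotonicity of a decay bound in the decay length: `a ≤ b·e^{−κd}`, `0 ≤ a`, `0 ≤ κ`, `D ≤ d` ⇒ `a ≤ b·e^{−κD}`
(the sign of `b` is forced by the bound itself). -/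
theorem le_mul_exp_of_le_mul_exp {a b κ d D : ℝ} (ha : 0 ≤ a) (h : a ≤ b * exp (-κ * d)) (hκ : 0 ≤ κ)
    (hD : D ≤ d) : a ≤ b * exp (-κ * D) := by
  have hb : 0 ≤ b := by
    by_contra hb
    push Not at hb
    have : b * exp (-κ * d) < 0 := mul_neg_of_neg_of_pos hb (exp_pos _)
    linarith
  have hmono : exp (-κ * d) ≤ exp (-κ * D) := by
    apply exp_le_exp.mpr
    have := mul_le_mul_of_nonneg_left hD hκ
    linarith
  exact h.trans (mul_le_mul_of_nonneg_left hmono hb)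

/-- [folklore] WRAPPING BOUND, E-species: a domain with `d_j(X) ≥ D` (a domain wrapping a torus of `N_j` blocks has
`d_j(X) ≥ N_j/M`, [Balaban1987RG1] p. 257) carries a term of sup norm `≤ E₀ e^{−κD}` on the running space — (2.27)(iv) =
(I.1.18), nothing more. [cite: Balaban1988Convergent, (2.27)(iv) p.259] -/
theorem wrappingBoundE (h : LFHyp T c k) (hκ : 0 ≤ c.κ) {j : ℕ} (h1 : 1 ≤ j) (hj : j ≤ k)
    (X : (T.sys j).Dom) (z : T.Pt j) {g : ℝ} (hg0 : 0 ≤ g) (hgγ : g ≤ c.γ) {φ : Φ}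
    (hφ : φ ∈ T.space j X (c.alpha0 (T.flow.g j)) (c.alpha1 (T.flow.g j))) {D : ℝ}
    (hD : D ≤ (T.sys j).dj X) : ‖T.E j X z g φ‖ ≤ c.E₀ * exp (-c.κ * D) :=
  le_mul_exp_of_le_mul_exp (norm_nonneg _) (h.boundE j h1 hj X z g φ hg0 hgγ hφ) hκ hD

/-- [folklore] WRAPPING BOUND, R-species, from (2.31) `|𝐑^{(j)}(X)| ≤ g_j^{κ₀} e^{−κ d_j(X)}`. [cite: Balaban1988Convergent, (2.31) p.260] -/
theorem wrappingBoundR (h : LFHyp T c k) (hκ : 0 ≤ c.κ) {j : ℕ} (h1 : 1 ≤ j) (hj : j ≤ k)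
    (X : (T.sys j).Dom) {φ : Φ} (hφ : φ ∈ T.space j X (c.alpha0 (T.flow.g j)) (c.alpha1 (T.flow.g j))) {D : ℝ}
    (hD : D ≤ (T.sys j).dj X) : ‖T.R j X φ‖ ≤ (T.flow.g j) ^ c.κ₀ * exp (-c.κ * D) :=
  le_mul_exp_of_le_mul_exp (norm_nonneg _) (h.boundR j h1 hj X φ hφ) hκ hD

/-- [folklore] WRAPPING BOUND, B-species (boundary terms), from (2.42) `|𝐁^{(j)}(X)| ≤ B₀ e^{−κ d_j(X)}`. [cite: Balaban1988Convergent, (2.42) p.261] -/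
theorem wrappingBoundB (h : LFHyp T c k) (hκ : 0 ≤ c.κ) {j : ℕ} (h1 : 1 ≤ j) (hj : j ≤ k)
    (X : (T.sys j).Dom) {φ : Φ} (hφ : φ ∈ T.spaceB j X) (a : 𝔄) {D : ℝ}
    (hD : D ≤ (T.sys j).dj X) : ‖T.B j X φ a‖ ≤ c.B₀ * exp (-c.κ * D) :=
  le_mul_exp_of_le_mul_exp (norm_nonneg _) (h.boundB j h1 hj X φ a hφ) hκ hD

end Docking

/-! ## §2  The wrapping census: log-depth threshold, scale sum, and "Bałaban's depth beats every power" -/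

/-- [folklore] Polynomial prefactor against half the decay: `xⁿ e^{−κx} ≤ n!·(2/κ)ⁿ·e^{−(κ/2)x}` (`x ≥ 0`, `κ > 0`),
from `yⁿ/n! ≤ eʸ` (`Real.pow_div_factorial_le_exp`) at `y = κx/2`. -/
theorem pow_mul_exp_neg_le (n : ℕ) {κ : ℝ} (hκ : 0 < κ) {x : ℝ} (hx : 0 ≤ x) :
    x ^ n * exp (-κ * x) ≤ (n.factorial : ℝ) * (2 / κ) ^ n * exp (-(κ / 2) * x) := by
  have hy : 0 ≤ κ / 2 * x := by positivity
  have hn : (0 : ℝ) < (n.factorial : ℝ) := by exact_mod_cast Nat.factorial_pos n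
  have h1 : (κ / 2 * x) ^ n / (n.factorial : ℝ) ≤ exp (κ / 2 * x) := Real.pow_div_factorial_le_exp _ hy n
  have h2 : (κ / 2 * x) ^ n ≤ (n.factorial : ℝ) * exp (κ / 2 * x) := by
    rw [div_le_iff₀ hn] at h1
    linarith
  have hx' : x ^ n = (2 / κ) ^ n * (κ / 2 * x) ^ n := by
    rw [← mul_pow]
    congr 1
    field_simp
  have hexp : exp (-κ * x) = exp (-(κ / 2) * x) * exp (-(κ / 2) * x) := by
    rw [← Real.exp_add]
    congr 1
    ring
  have hee : exp (κ / 2 * x) * exp (-(κ / 2) * x) = 1 := by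
    rw [← Real.exp_add, show κ / 2 * x + -(κ / 2) * x = 0 by ring, Real.exp_zero]
  calc x ^ n * exp (-κ * x)
      = (2 / κ) ^ n * (κ / 2 * x) ^ n * (exp (-(κ / 2) * x) * exp (-(κ / 2) * x)) := by rw [hx', hexp]
    _ ≤ (2 / κ) ^ n * ((n.factorial : ℝ) * exp (κ / 2 * x)) * (exp (-(κ / 2) * x) * exp (-(κ / 2) * x)) := by
        gcongr
    _ = (n.factorial : ℝ) * (2 / κ) ^ n * exp (-(κ / 2) * x) * (exp (κ / 2 * x) * exp (-(κ / 2) * x)) := by ring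
    _ = (n.factorial : ℝ) * (2 / κ) ^ n * exp (-(κ / 2) * x) := by rw [hee, mul_one]

/-- [folklore] THE LOG-DEPTH THRESHOLD: if `x ≥ (2/κ)·log(n!(2/κ)ⁿ/δ)` then `xⁿe^{−κx} ≤ δ`.  With `δ = g^A/L`-type budgets
this is a depth LINEAR in `log(1/g)`. -/
theorem pow_mul_exp_neg_le_of_log_le (n : ℕ) {κ δ x : ℝ} (hκ : 0 < κ) (hδ : 0 < δ) (hx : 0 ≤ x)
    (hlog : 2 / κ * log ((n.factorial : ℝ) * (2 / κ) ^ n / δ) ≤ x) : x ^ n * exp (-κ * x) ≤ δ := by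
  have hA : 0 < (n.factorial : ℝ) * (2 / κ) ^ n := by positivity
  refine (pow_mul_exp_neg_le n hκ hx).trans ?_
  have h1 : log ((n.factorial : ℝ) * (2 / κ) ^ n / δ) ≤ κ / 2 * x := by
    have h := mul_le_mul_of_nonneg_left hlog (le_of_lt (half_pos hκ))
    have e : κ / 2 * (2 / κ * log ((n.factorial : ℝ) * (2 / κ) ^ n / δ)) = log ((n.factorial : ℝ) * (2 / κ) ^ n / δ) := by
      rw [← mul_assoc, show κ / 2 * (2 / κ) = 1 by field_simp, one_mul]
    linarith
  have h2 : exp (-(κ / 2) * x) ≤ δ / ((n.factorial : ℝ) * (2 / κ) ^ n) := by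
    rw [← Real.exp_log (div_pos hδ hA)]
    apply exp_le_exp.mpr
    rw [Real.log_div hδ.ne' hA.ne']
    rw [Real.log_div hA.ne' hδ.ne'] at h1
    linarith
  calc (n.factorial : ℝ) * (2 / κ) ^ n * exp (-(κ / 2) * x)
      ≤ (n.factorial : ℝ) * (2 / κ) ^ n * (δ / ((n.factorial : ℝ) * (2 / κ) ^ n)) := by gcongr
    _ = δ := by field_simp

/-- [folklore] THE SCALES BELOW THE TOP ADD AT MOST A FACTOR 2: with torus sizes `N_{K−i} = Mⁱ·x` (`M ≥ 1`) and per-scale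
weights `(Mⁱx)ⁿ e^{−κMⁱx}`, once `e^{κ(M−1)x} ≥ 2Mⁿ` each scale is at most half the one above it, so
`Σ_{i<m} (Mⁱx)ⁿe^{−κMⁱx} ≤ 2·xⁿe^{−κx}`. -/
theorem scaleSum_le (n m : ℕ) {M κ x : ℝ} (hM : 1 ≤ M) (hκ : 0 ≤ κ) (hx : 0 ≤ x)
    (hsep : 2 * M ^ n ≤ exp (κ * (M - 1) * x)) :
    ∑ i ∈ range m, (M ^ i * x) ^ n * exp (-κ * (M ^ i * x)) ≤ 2 * (x ^ n * exp (-κ * x)) := by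
  have hM0 : 0 ≤ M := le_trans zero_le_one hM
  -- one step down costs at least a factor 2
  have hstep : ∀ i : ℕ, (M ^ (i + 1) * x) ^ n * exp (-κ * (M ^ (i + 1) * x))
      ≤ ((M ^ i * x) ^ n * exp (-κ * (M ^ i * x))) / 2 := by
    intro i
    have hMi : 1 ≤ M ^ i := one_le_pow₀ hM
    have hyx : x ≤ M ^ i * x := le_mul_of_one_le_left hx hMi
    have hsep' : 2 * M ^ n ≤ exp (κ * (M - 1) * (M ^ i * x)) := by
      refine hsep.trans (exp_le_exp.mpr ?_)
      have := mul_le_mul_of_nonneg_left hyx (mul_nonneg hκ (by linarith : (0:ℝ) ≤ M - 1))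
      linarith
    have hf : (M ^ (i + 1) * x) ^ n * exp (-κ * (M ^ (i + 1) * x))
        = M ^ n * exp (-(κ * (M - 1) * (M ^ i * x))) * ((M ^ i * x) ^ n * exp (-κ * (M ^ i * x))) := by
      rw [pow_succ, show M ^ i * M * x = M * (M ^ i * x) by ring, mul_pow,
        show -κ * (M * (M ^ i * x)) = -(κ * (M - 1) * (M ^ i * x)) + -κ * (M ^ i * x) by ring, Real.exp_add]
      ring
    rw [hf]
    have hfi : 0 ≤ (M ^ i * x) ^ n * exp (-κ * (M ^ i * x)) := by positivity
    have hhalf : M ^ n * exp (-(κ * (M - 1) * (M ^ i * x))) ≤ 1 / 2 := by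
      have hpos : 0 < exp (κ * (M - 1) * (M ^ i * x)) := exp_pos _
      rw [Real.exp_neg, ← div_eq_mul_inv, div_le_iff₀ hpos]
      linarith
    calc M ^ n * exp (-(κ * (M - 1) * (M ^ i * x))) * ((M ^ i * x) ^ n * exp (-κ * (M ^ i * x)))
        ≤ 1 / 2 * ((M ^ i * x) ^ n * exp (-κ * (M ^ i * x))) := by gcongr
      _ = ((M ^ i * x) ^ n * exp (-κ * (M ^ i * x))) / 2 := by ring
  -- hence geometric decay from the top
  have hdec : ∀ i : ℕ, (M ^ i * x) ^ n * exp (-κ * (M ^ i * x)) ≤ (x ^ n * exp (-κ * x)) / 2 ^ i := by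
    intro i
    induction i with
    | zero => simp
    | succ i ih =>
        calc (M ^ (i + 1) * x) ^ n * exp (-κ * (M ^ (i + 1) * x))
            ≤ ((M ^ i * x) ^ n * exp (-κ * (M ^ i * x))) / 2 := hstep i
          _ ≤ ((x ^ n * exp (-κ * x)) / 2 ^ i) / 2 := by gcongr
          _ = (x ^ n * exp (-κ * x)) / 2 ^ (i + 1) := by rw [pow_succ]; ring
  have hf0 : 0 ≤ x ^ n * exp (-κ * x) := by positivity
  have hgeom : ∑ i ∈ range m, ((1:ℝ) / 2) ^ i ≤ 2 := by
    rw [geom_sum_eq (show (1:ℝ) / 2 ≠ 1 by norm_num) m]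
    have h2 : (0:ℝ) ≤ (1 / 2) ^ m := by positivity
    rw [show (((1:ℝ) / 2) ^ m - 1) / (1 / 2 - 1) = 2 * (1 - (1 / 2) ^ m) by ring]
    linarith
  calc ∑ i ∈ range m, (M ^ i * x) ^ n * exp (-κ * (M ^ i * x))
      ≤ ∑ i ∈ range m, (x ^ n * exp (-κ * x)) / 2 ^ i := sum_le_sum fun i _ => hdec i
    _ = (x ^ n * exp (-κ * x)) * ∑ i ∈ range m, ((1:ℝ) / 2) ^ i := by
        rw [mul_sum]
        refine sum_congr rfl fun i _ => ?_
        rw [div_pow, one_pow]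
        ring
    _ ≤ (x ^ n * exp (-κ * x)) * 2 := by gcongr
    _ = 2 * (x ^ n * exp (-κ * x)) := by ring

/-- [folklore] THE PER-TIME-STEP WRAPPING BUDGET.  Scales counted down from the top (`i = 0` the top, torus `Mⁱ·N` blocks at
scale `K−i`); if the holonomy-dependent (= wrapping) terms of scale `K−i` contribute at most `V·E·(MⁱN)ⁿe^{−κMⁱN}` in sup norm
per fine time step (count `× ` sup bound, shape-entropy absorbed in `κ`), the depth satisfies the log-threshold for `δ/2` and the
scale-separation condition, then the whole tower contributes `≤ V·E·δ`. -/
theorem census (n m : ℕ) {M κ N V E δ : ℝ} (hM : 1 ≤ M) (hκ : 0 < κ) (hN : 0 ≤ N) (hV : 0 ≤ V)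
    (hE : 0 ≤ E) (hδ : 0 < δ) (hsep : 2 * M ^ n ≤ exp (κ * (M - 1) * N))
    (hdepth : 2 / κ * log ((n.factorial : ℝ) * (2 / κ) ^ n / (δ / 2)) ≤ N)
    (w : ℕ → ℝ) (hw : ∀ i, i < m → w i ≤ V * E * ((M ^ i * N) ^ n * exp (-κ * (M ^ i * N)))) :
    ∑ i ∈ range m, w i ≤ V * E * δ := by
  have htop : N ^ n * exp (-κ * N) ≤ δ / 2 :=
    pow_mul_exp_neg_le_of_log_le n hκ (half_pos hδ) hN hdepth
  calc ∑ i ∈ range m, w i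
      ≤ ∑ i ∈ range m, V * E * ((M ^ i * N) ^ n * exp (-κ * (M ^ i * N))) :=
        sum_le_sum fun i hi => hw i (mem_range.mp hi)
    _ = V * E * ∑ i ∈ range m, (M ^ i * N) ^ n * exp (-κ * (M ^ i * N)) := by rw [mul_sum]
    _ ≤ V * E * (2 * (N ^ n * exp (-κ * N))) :=
        mul_le_mul_of_nonneg_left (scaleSum_le n m hM hκ.le hN hsep) (mul_nonneg hV hE)
    _ ≤ V * E * (2 * (δ / 2)) :=
        mul_le_mul_of_nonneg_left (by linarith [htop]) (mul_nonneg hV hE)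
    _ = V * E * δ := by ring

/-- [folklore] BAŁABAN'S DEPTH BEATS EVERY POWER.  The complete scheme stops at `N_K/M ≥ 100·R_K ≥ 100·(log g_K⁻²)^r` with `r ≥ 2`
([Balaban1988Convergent] (2.5) p. 255, p. 245); at any depth `x ≥ a·(log g⁻²)²` (`a > 0`) and for `g` small enough (an explicit
threshold `u₀` on `log g⁻²`), `xⁿe^{−κx} ≤ g^A` for every fixed power `A`: the holonomy dependence handed over by the tower is
superpolynomially small in `g`, in particular `≪ Λ² ∼ g^{4/3}`. -/
theorem depth_beats_any_power (n A : ℕ) {κ a : ℝ} (hκ : 0 < κ) (ha : 0 < a) :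
    ∃ u₀ : ℝ, 0 < u₀ ∧ ∀ g : ℝ, 0 < g → g < 1 → u₀ ≤ log ((g ^ 2)⁻¹) →
      ∀ x : ℝ, a * (log ((g ^ 2)⁻¹)) ^ 2 ≤ x → x ^ n * exp (-κ * x) ≤ g ^ A := by
  set C : ℝ := (n.factorial : ℝ) * (2 / κ) ^ n with hC
  have hCpos : 0 < C := by positivity
  refine ⟨max 1 ((2 / κ * |log C| + A / κ) / a), lt_of_lt_of_le zero_lt_one (le_max_left _ _), ?_⟩
  intro g hg hg1 hu x hx
  set u : ℝ := log ((g ^ 2)⁻¹) with hudef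
  have hu1 : 1 ≤ u := le_trans (le_max_left _ _) hu
  have hu2 : (2 / κ * |log C| + A / κ) / a ≤ u := le_trans (le_max_right _ _) hu
  have hupos : 0 ≤ u := le_trans zero_le_one hu1
  have hulog : u = -2 * log g := by
    rw [hudef, Real.log_inv, Real.log_pow]; push_cast; ring
  have hgA : 0 < g ^ A := pow_pos hg A
  have hx0 : 0 ≤ x := le_trans (by positivity) hx
  apply pow_mul_exp_neg_le_of_log_le n hκ hgA hx0
  -- the threshold (2/κ)·log(C/g^A) = (2/κ) log C + (A/κ)·u is below a·u² ≤ x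
  have hlogCg : log (C / g ^ A) = log C + (A : ℝ) / 2 * u := by
    rw [Real.log_div hCpos.ne' hgA.ne', Real.log_pow, hulog]; ring
  rw [← hC, hlogCg]
  have hkey : 2 / κ * (log C + (A : ℝ) / 2 * u) ≤ a * u ^ 2 := by
    have h3 : 2 / κ * |log C| + A / κ ≤ a * u := by
      have := mul_le_mul_of_nonneg_left hu2 ha.le
      rwa [mul_div_cancel₀ _ ha.ne'] at this
    have h4 : log C ≤ |log C| := le_abs_self _
    have h5 : 0 ≤ 2 / κ := by positivity
    have h6 : 2 / κ * log C ≤ 2 / κ * |log C| := mul_le_mul_of_nonneg_left h4 h5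
    have h7 : 2 / κ * |log C| ≤ 2 / κ * |log C| * u := le_mul_of_one_le_right (by positivity) hu1
    have h8 : (2 / κ * |log C| + A / κ) * u ≤ a * u * u := mul_le_mul_of_nonneg_right h3 hupos
    have h9 : 2 / κ * (log C + (A : ℝ) / 2 * u) = 2 / κ * log C + A / κ * u := by ring
    rw [h9]
    nlinarith
  exact hkey.trans hx

end Summit.QuantumFields.YangMills.Cruxes.DressedRitz.CauchyParity.LogDepth

end
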